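import Mathlib.Data.Matrix.ColumnRowPartitioned
import Literature.Computability.AlgebraicComplexity.IMMCompleteness
import Literature.Computability.AlgebraicComplexity.LayeredABPInvRepr
import Literature.Computability.AlgebraicComplexity.SkewCircuitAffineSubstitution
import HarnessLib

/-!
# `VBP = VP_ws` is closed under composition (Bürgisser 2024 survey, §3.1) — PROOFS, through
# inverse read-outs `vᵀ B⁻¹ w` (algebraic branching programs in matrix form)

Topic `Computability/AlgebraicComplexity`. Cell `val-lit`, row Bur2024-A (P. Bürgisser,
*Completeness classes in algebraic complexity theory*, arXiv:2406.06217, 2024), §3.1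
"Robustness" (held text `paper:arxiv-2406.06217`, p0013 L10–L15):

> It is easy to see that all the complexity classes introduced before are closed under
> `p`-projections and with respect to several natural operations, such as taking sums, products,
> or compositions. The latter means forming `(f_n(g_1, …, g_{v(n)}))` from sequences `(f_n)` and
> `(g_n)`, where `f_n ∈ 𝔽[x_1, …, x_{v(n)}]`.

For `VP`, `VNP` and `VF` the composition clause is `IsVPFamily.aeval/.comp`,
`IsVNPFamily.aeval/.comp`, `isPBounded_formulaComplexity_aeval/_comp`
(`VNPClosedUnderComposition.lean`). This file proves it for the remaining class of the sentence,
`VBP = VP_ws` (`IsVPwsFamily`, weakly-skew circuits of p-bounded size,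
`BLMW11KroneckerApproximation.lean`; Bürgisser 2024 Def. 2.9 / Rem. 2.10(3)):

* `IsVPwsFamily.aeval` — substitution form: `(f_n) ∈ VP_ws`, inner tuples `g_n = (g_{n,i})_i` in
  `k[τ_n]` with `#τ_n` p-bounded and `L_ws(g_{n,i}) ≤ B(n)`, `B` p-bounded ⟹ `(f_n(g_n)) ∈ VP_ws`;
* `IsVPwsFamily.comp` — the printed form `(f_n(g_0, …, g_{v(n)-1}))` for `VP_ws` families
  `(f_n)`, `(g_n)` (with `v` p-bounded, see the docstring);
* `IsVPwsFamily.add`, `IsVPwsFamily.mul` (§G) — the "sums, products" clauses of the same sentence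
  for `VBP` (`wsComplexity_add_le_four`; products through inverse read-outs,
  `hasInvRepr_mul_of_wsComplexity_le`, `wsComplexity_mul_le_poly` — a polynomial, not the printed
  linear, bound);
* on the way, for single polynomials over every commutative ring:
  `HI16Skew.exists_layered_readout` / `HI16Skew.hasInvRepr_of_isSkew` (a fan-in-two skew circuit
  with `s` gates is a read-out `vᵀ B⁻¹ w`, `B` affine with `det B = 1`, of size
  `(3s+4)(6s+4) + 2`), `hasInvRepr_of_wsComplexity_le`, the substitution gadget
  `hasInvRepr_readOut`, `HI16Skew.hasInvRepr_aeval_of_isSkew`,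
  `hasInvRepr_aeval_of_wsComplexity_le`, `wsComplexity_le_of_hasDetRepr'` (every commutative
  ring; the tree's `wsComplexity_le_of_hasDetRepr` is `k = ℂ`), `wsComplexity_le_of_hasInvRepr`,
  and the class-level `isVPwsFamily_of_hasInvRepr`, `isVPwsFamily_iff_exists_hasInvRepr`
  (`VP_ws` = families with p-bounded inverse read-outs, i.e. polynomial-size algebraic branching
  programs in matrix form — Malod–Portier's `VP_ws = VBP` in the tree's `HasInvRepr` currency).

## Proof (algebraic branching programs as matrix inverses; no circuit surgery)

The classical proof substitutes a branching program for `g_i` into every edge labelled `x_i` of a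
branching program for `f`. We run it in the matrix form of BCS 1997, Thm. (21.27) / Valiant 1979
§2, with the tree's `HasInvRepr g m` (`VPDeterminantalQPProofs.lean`: `g = vᵀ B⁻¹ w`, `B` a matrix
of affine linear forms with `det B = 1` of size `≤ m`, `v, w` constant):

1. (§A–§B) **Skew circuits are inverse read-outs.** For a fan-in-two skew circuit `P` with `s`
   gates, `P.eval = pathValue (todaE P) s t` (`HI16Skew.eval_eq_W_vT`, Malod–Portier's circuit
   digraph on `3s+2` vertices `V`), and the step matrix `U = [[E, 1], [0, −1]]` of
   `IMMCompleteness.lean` has `(U^{|V|+1})_{(s,1),(t,2)} = ±pathValue`. Unrolling `U` in time —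
   vertices `Fin (|V|+2) × (V ⊕ V)`, the block `U` between consecutive layers
   (`layerShift_pow_apply`) — gives a LAYERED adjacency matrix `N` with variable/constant entries
   and `P.eval = ±(N^{|V|+1})_{s₀ t₀} = ±((1 − N)⁻¹)_{s₀ t₀}` (the tree's
   `LayeredABPComputes.det_one_sub` / `inv_one_sub_apply`), whence `HasInvRepr P.eval` of size
   `(3s+4)(6s+4) + 2` (`LayeredABPComputes.hasInvRepr`, sign by `HasInvRepr.mul`).
2. (§C) **Substitution gadget.** `aeval g` passes through a read-out with `det B = 1`
   (`aeval_readOut`: both inverses are adjugates). If `det D = 1` and every ENTRY `D_{pq}` has a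
   read-out `v_{pq}ᵀ B_{pq}⁻¹ w_{pq}` of size `≤ b`, border the block-diagonal `A = ⊕ B_{pq}` by
   the constant blocks `W = (w_{pq} e_qᵀ)`, `V = (−e_p v_{pq}ᵀ)`: then `V A⁻¹ W = −D`, so the
   Schur complement of `A` in `T = [[A, W], [V, 0]]` is `D`, `det T = det D = 1`, `T` is affine,
   and the lower-right block of `T⁻¹` is `D⁻¹` (`Matrix.invOf_fromBlocks₁₁_eq`): every constant
   read-out of `D⁻¹` has an inverse read-out of size `≤ |ι|² b + |ι|` (`hasInvRepr_readOut`,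
   induction over the entries with `Matrix.fromBlocks` / `fromRows` / `fromCols`).
3. (§D) **Compose.** `P.eval(g) = ±((1 − N)(g))⁻¹_{s₀ t₀}` and the entries of `(1 − N)(g)` are
   `δ_{pq} − g_i` or constants, each with a read-out of size `≤ b + 6` when the `g_i` have
   read-outs of size `≤ b` (`HI16Skew.hasInvRepr_aeval_of_isSkew`; no hypothesis on the variable
   type of `P`); with `L_skew ≤ 4 L_ws` (`ArithCircuit.skewComplexity_le_four_mul_wsComplexity`)
   this is `hasInvRepr_aeval_of_wsComplexity_le`.
4. (§E–§F) **Back to circuits.** `HasInvRepr g m → HasDetRepr g (m+1)` (tree, Schur bordering)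
   and an affine determinantal representation of size `N` is an affine substitution into the
   tree's skew circuit for `det_N` (`wsComplexity_aeval_affine_le`, `skewComplexity_detPoly_le`):
   `L_ws(g) ≤ ((N+2)(4N³+7)² + N²)(2 #τ + 3)`. All bounds are polynomial, whence the class-level
   statements by the tree's `IsPBounded` calculus.

Theorems only: no definitions, no named facts, no `sorry` (D-0026). Scope: every commutative
ring of coefficients. Honest framing: closure bookkeeping of Valiant's classes; `VP ≠ VNP` is NOT
proved and nothing here bears on it.

## References

* [Burgisser2024Completeness] P. Bürgisser, *Completeness classes in algebraic complexity
  theory*, arXiv:2406.06217 (2024), §3.1 (p0013 L10–L15), Def. 2.9, Rem. 2.10(3), Prop. 2.21.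
* [BurgisserClausenShokrollahi1997] P. Bürgisser, M. Clausen, M. A. Shokrollahi, *Algebraic
  Complexity Theory*, Springer 1997, Thm. (21.27) (proof, properties (A)–(C)), Lemma (21.28).
* [MalodPortier2008] G. Malod, N. Portier, *Characterizing Valiant's algebraic complexity
  classes*, J. Complexity 24 (2008), Lemma 5, Prop. 5, Lemma 6 (`VP_ws = VBP`).
* [BurgisserEtAl2011] Bürgisser–Landsberg–Manivel–Weyman, SIAM J. Comput. 40 (2011), §9.1–§9.4.
* [Valiant1979] L. G. Valiant, *Completeness classes in algebra*, STOC 1979, §2.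
-/

noncomputable section

open MvPolynomial Finset Matrix

namespace Literature.Computability.AlgebraicComplexity

universe u v w

/-! ## §A. Layer-shift matrices: time-unrolling a square matrix into a layered digraph -/

section LayerShift

variable {R : Type u} [Semiring R] {W : Type v} [Fintype W] [DecidableEq W]

/-- **Powers of a layer-shift matrix.** On the vertex set `Fin (L+1) × W` (layers `0, …, L`),
let `N` carry the block `U` from each layer `i` to layer `i + 1` and nothing else. Then `N^m`
carries exactly `U^m` from layer `i` to layer `i + m`: the walks of length `m` in the unrolled
digraph are the walks of length `m` of `U`, shifted `m` layers up (the layering used to read a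
matrix power as a layered algebraic branching program: "every `s–t` path has the same length",
Andrews–Forbes 2022, §3.2). [cite: AndrewsForbes2022, §3.2 (layered ABPs)] -/
theorem layerShift_pow_apply (U : Matrix W W R) (L m : ℕ) (i j : Fin (L + 1)) (a b : W) :
    ((Matrix.of fun (p q : Fin (L + 1) × W) =>
        if (q.1 : ℕ) = p.1 + 1 then U p.2 q.2 else 0) ^ m) (i, a) (j, b) =
      if (j : ℕ) = i + m then (U ^ m) a b else 0 := by
  induction m generalizing j b with
  | zero =>
    rw [pow_zero, pow_zero, add_zero]
    by_cases hij : (j : ℕ) = i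
    · have : j = i := Fin.ext hij
      subst this
      rw [if_pos rfl]
      by_cases hab : a = b
      · subst hab; simp
      · rw [Matrix.one_apply_ne hab, Matrix.one_apply_ne]
        exact fun h => hab (Prod.ext_iff.1 h).2
    · rw [if_neg hij, Matrix.one_apply_ne]
      exact fun h => hij (by rw [show i = j from (Prod.ext_iff.1 h).1])
  | succ m ih =>
    rw [pow_succ, Matrix.mul_apply, pow_succ]
    simp_rw [ih, Matrix.of_apply]
    rw [Fintype.sum_prod_type]
    by_cases hj : (j : ℕ) = i + (m + 1)
    · rw [if_pos hj, Matrix.mul_apply]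
      have him : i + m < L + 1 := by have := j.isLt; omega
      rw [Finset.sum_eq_single (⟨i + m, him⟩ : Fin (L + 1))]
      · refine Finset.sum_congr rfl fun c _ => ?_
        rw [if_pos rfl, if_pos (by simp [hj]; omega)]
      · intro l _ hl
        refine Finset.sum_eq_zero fun c _ => ?_
        have : ¬ ((l : ℕ) = i + m) := fun h => hl (Fin.ext h)
        rw [if_neg this, zero_mul]
      · intro h; exact absurd (Finset.mem_univ _) h
    · rw [if_neg hj]
      refine Finset.sum_eq_zero fun l _ => Finset.sum_eq_zero fun c _ => ?_
      by_cases hl : (l : ℕ) = i + m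
      · have : ¬ ((j : ℕ) = l + 1) := by omega
        rw [if_neg this, mul_zero]
      · rw [if_neg hl, zero_mul]

end LayerShift

/-! ## §B. Skew circuits are read-outs of layered unipotent matrices (algebraic branching programs) -/

section VarOrConst

variable {k : Type u} [CommRing k] {ρ : Type v}

/-- A variable has total degree `≤ 1` (over the zero ring it is `0`). [folklore] -/
private theorem totalDegree_X_le_one' (x : ρ) : (X x : MvPolynomial ρ k).totalDegree ≤ 1 := by
  rcases subsingleton_or_nontrivial k with hk | hk
  · rw [Subsingleton.elim (X x : MvPolynomial ρ k) 0, totalDegree_zero]; exact Nat.zero_le _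
  · rw [totalDegree_X]

/-- Variables and constants are affine. [folklore] -/
private theorem totalDegree_le_one_of_isVarOrConst {p : MvPolynomial ρ k}
    (hp : (∃ x, p = X x) ∨ ∃ c, p = C c) : p.totalDegree ≤ 1 := by
  rcases hp with ⟨x, rfl⟩ | ⟨c, rfl⟩
  · exact totalDegree_X_le_one' x
  · rw [totalDegree_C]; exact Nat.zero_le _

/-- The entries of the step matrix `[[E, 1], [0, −1]]` of a digraph with variable/constant labels
are variables or constants. [cite: Burgisser2024Completeness, Cor. 2.24 (proof)] -/
theorem fromBlocks_stepMatrix_isVarOrConst {V : Type w} [DecidableEq V]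
    {E : Matrix V V (MvPolynomial ρ k)} (hE : ∀ u v, (∃ x, E u v = X x) ∨ ∃ c, E u v = C c)
    (u v : V ⊕ V) :
    (∃ x, (Matrix.fromBlocks E 1 0 (-1) : Matrix (V ⊕ V) (V ⊕ V) (MvPolynomial ρ k)) u v = X x) ∨
      ∃ c, (Matrix.fromBlocks E 1 0 (-1) : Matrix (V ⊕ V) (V ⊕ V) (MvPolynomial ρ k)) u v = C c := by
  have h0 : (∃ x, (0 : MvPolynomial ρ k) = X x) ∨ ∃ c, (0 : MvPolynomial ρ k) = C c :=
    Or.inr ⟨0, (map_zero C).symm⟩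
  rcases u with u | u <;> rcases v with v | v
  · rw [Matrix.fromBlocks_apply₁₁]; exact hE u v
  · rw [Matrix.fromBlocks_apply₁₂]
    by_cases huv : u = v
    · subst huv; exact Or.inr ⟨1, by rw [Matrix.one_apply_eq, map_one]⟩
    · rw [Matrix.one_apply_ne huv]; exact h0
  · rw [Matrix.fromBlocks_apply₂₁, Matrix.zero_apply]; exact h0
  · rw [Matrix.fromBlocks_apply₂₂, Matrix.neg_apply]
    by_cases huv : u = v
    · subst huv; exact Or.inr ⟨-1, by rw [Matrix.one_apply_eq, map_neg, map_one]⟩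
    · rw [Matrix.one_apply_ne huv, neg_zero]; exact h0

end VarOrConst

namespace HI16Skew

open ArithCircuit

variable {k : Type u} [CommRing k] {ρ : Type v} (P : ArithCircuit k ρ)

/-- `|TV s| = 3s + 2`. [folklore] -/
private theorem card_TV'' (s : ℕ) : Fintype.card (TV s) = 3 * s + 2 := by
  simp only [Fintype.card_sum, Fintype.card_unit, Fintype.card_prod, Fintype.card_fin]
  ring

/-- **A skew circuit is a read-out of a layered digraph with variable/constant labels**
(the algebraic-branching-program form of a skew circuit; Malod–Portier 2008, Lemma 5 / Bürgisser
2024, Prop. 2.21, via the tree's circuit digraph `todaE` unrolled in time): for a fan-in-two skew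
circuit `P` with `s` gates there are, on `K = (3s+4)(6s+4)` vertices `Fin K`, a layer function, a
LAYERED adjacency matrix `N` (every edge goes one layer up) whose entries are variables or
constants, a source `s₀` on layer `0` and a sink `t₀` on layer `3s+3`, with
`P.eval = (−1)^{3s+3} · (N^{3s+3})_{s₀ t₀}` — the vertices are `Fin (3s+4) × (V ⊕ V)` for the
`3s+2` vertices `V` of `todaE P`, the block between consecutive layers is the step matrix
`[[todaE P, 1], [0, −1]]` of `IMMCompleteness.lean`, and `(N^{3s+3})_{s₀ t₀}` is its
`((s,1),(t,2))` power entry `(−1)^{3s+3} · pathValue (todaE P) s t = (−1)^{3s+3} · P.eval`.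
[cite: MalodPortier2008, Lemma 5] [cite: Burgisser2024Completeness, Prop. 2.21] -/
theorem exists_layered_readout (h2 : P.IsFanInTwo) (hsk : P.IsSkew) :
    ∃ (layer : Fin ((3 * P.size + 4) * (6 * P.size + 4)) → ℕ)
      (N : Matrix (Fin ((3 * P.size + 4) * (6 * P.size + 4)))
        (Fin ((3 * P.size + 4) * (6 * P.size + 4))) (MvPolynomial ρ k))
      (s₀ t₀ : Fin ((3 * P.size + 4) * (6 * P.size + 4))),
      (∀ u v, N u v ≠ 0 → layer v = layer u + 1) ∧
      (∀ u v, (∃ x, N u v = X x) ∨ ∃ c, N u v = C c) ∧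
      layer s₀ = 0 ∧ layer t₀ = 3 * P.size + 3 ∧
      P.eval = C ((-1 : k) ^ (3 * P.size + 3)) * (N ^ (3 * P.size + 3)) s₀ t₀ := by
  classical
  -- the unrolled digraph on `Fin (3s+4) × (V ⊕ V)`
  let V := TV P.size
  let E : Matrix V V (MvPolynomial ρ k) := todaE P
  let U : Matrix (V ⊕ V) (V ⊕ V) (MvPolynomial ρ k) := Matrix.fromBlocks E 1 0 (-1)
  let Wt := Fin (3 * P.size + 3 + 1) × (V ⊕ V)
  let N₀ : Matrix Wt Wt (MvPolynomial ρ k) :=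
    Matrix.of fun p q => if (q.1 : ℕ) = p.1 + 1 then U p.2 q.2 else 0
  have hcard : Fintype.card Wt = (3 * P.size + 4) * (6 * P.size + 4) := by
    show Fintype.card (Fin (3 * P.size + 3 + 1) × (TV P.size ⊕ TV P.size)) = _
    rw [Fintype.card_prod, Fintype.card_fin, Fintype.card_sum, card_TV'']
    ring
  let e : Wt ≃ Fin ((3 * P.size + 4) * (6 * P.size + 4)) := Fintype.equivFinOfCardEq hcard
  let sW : Wt := (0, Sum.inl vS)
  let tW : Wt := (Fin.last (3 * P.size + 3), Sum.inr vT)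
  refine ⟨fun v => ((e.symm v).1 : ℕ), Matrix.reindex e e N₀, e sW, e tW, ?_, ?_, ?_, ?_, ?_⟩
  · -- layered
    intro u v huv
    simp only [Matrix.reindex_apply, Matrix.submatrix_apply, N₀, Matrix.of_apply, ne_eq,
      ite_eq_right_iff, Classical.not_imp] at huv
    exact huv.1
  · -- variable/constant labels
    intro u v
    simp only [Matrix.reindex_apply, Matrix.submatrix_apply, N₀, Matrix.of_apply]
    split_ifs
    · exact fromBlocks_stepMatrix_isVarOrConst (todaE_isVarOrConst P) _ _
    · exact Or.inr ⟨0, (map_zero C).symm⟩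
  · simp [sW]
  · simp [tW]
  · -- the value
    have hpow : (Matrix.reindex e e N₀) ^ (3 * P.size + 3) =
        Matrix.reindex e e (N₀ ^ (3 * P.size + 3)) := by
      have := map_pow (Matrix.reindexAlgEquiv k (MvPolynomial ρ k) e) N₀ (3 * P.size + 3)
      simpa [Matrix.coe_reindexAlgEquiv] using this.symm
    rw [hpow, Matrix.reindex_apply, Matrix.submatrix_apply, Equiv.symm_apply_apply,
      Equiv.symm_apply_apply]
    rw [show (N₀ ^ (3 * P.size + 3)) sW tW =
        if ((Fin.last (3 * P.size + 3) : Fin (3 * P.size + 3 + 1)) : ℕ) = (0 : Fin (3 * P.size + 3 + 1)) + (3 * P.size + 3)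
        then (U ^ (3 * P.size + 3)) (Sum.inl vS) (Sum.inr vT) else 0 from
      layerShift_pow_apply U (3 * P.size + 3) (3 * P.size + 3) 0 (Fin.last _) (Sum.inl vS) (Sum.inr vT)]
    rw [if_pos (by simp)]
    have hn : 3 * P.size + 3 = Fintype.card V + 1 := by rw [card_TV'']
    rw [hn, stepMatrix_pow_apply_inl_inr E (show (vS : TV P.size) ≠ vT by simp),
      eval_eq_W_vT P h2 hsk, ← mul_assoc, map_pow, map_neg, map_one, ← pow_add, ← two_mul,
      pow_mul, neg_one_sq, one_pow, one_mul]
    rfl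

/-- **A skew circuit has an inverse read-out of quadratic size**: a fan-in-two skew circuit with
`s` gates computes `vᵀ B⁻¹ w` for an affine matrix `B` (here `1 − N` for the layered `N` of
`exists_layered_readout`, times the sign) with `det B = 1`, of size `(3s+4)(6s+4) + 2` — the
tree's `HasInvRepr` (`VPDeterminantalQPProofs.lean`; Valiant 1979 §2, BCS 1997 Thm. (21.27)(C)),
through `LayeredABPComputes.hasInvRepr`. [cite: MalodPortier2008, Lemma 5]
[cite: BurgisserClausenShokrollahi1997, Thm. (21.27) (proof, property (C))] -/
theorem hasInvRepr_of_isSkew (h2 : P.IsFanInTwo) (hsk : P.IsSkew) :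
    HasInvRepr P.eval ((3 * P.size + 4) * (6 * P.size + 4) + 2) := by
  classical
  obtain ⟨layer, N, s₀, t₀, hlay, hvc, hls, hlt, hev⟩ := exists_layered_readout P h2 hsk
  have hdeg : ∀ u v, (N u v).totalDegree ≤ 1 := fun u v =>
    totalDegree_le_one_of_isVarOrConst (hvc u v)
  have hABP : LayeredABPComputes ((3 * P.size + 4) * (6 * P.size + 4))
      ((N ^ (layer t₀ - layer s₀)) s₀ t₀) :=
    ⟨_, le_rfl, layer, s₀, t₀, N, hlay, hdeg, rfl⟩
  have h1 : HasInvRepr ((N ^ (3 * P.size + 3)) s₀ t₀) ((3 * P.size + 4) * (6 * P.size + 4)) := by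
    have := hABP.hasInvRepr
    rwa [hlt, hls, Nat.sub_zero] at this
  have h2' : HasInvRepr (C ((-1 : k) ^ (3 * P.size + 3)) : MvPolynomial ρ k) 2 :=
    HasInvRepr.of_totalDegree_le_one (by rw [totalDegree_C]; exact Nat.zero_le _)
  have := h2'.mul h1
  rw [← hev] at this
  exact this.mono (by omega)

end HI16Skew

/-- **`L_ws(g) ≤ r` gives an inverse read-out of size `(12r+4)(24r+4) + 2`** (a size-optimal
well-formed skew circuit, `HI16Skew.skewComplexity_attained`, has `L_skew(g) ≤ 4 L_ws(g)`
gates, `ArithCircuit.skewComplexity_le_four_mul_wsComplexity`).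
[cite: MalodPortier2008, Lemma 5] [cite: BurgisserEtAl2011, §9.4 (skew vs weakly-skew)] -/
theorem hasInvRepr_of_wsComplexity_le {k : Type u} [CommRing k] {ρ : Type v}
    {g : MvPolynomial ρ k} {r : ℕ} (hg : wsComplexity g ≤ r) :
    HasInvRepr g ((12 * r + 4) * (24 * r + 4) + 2) := by
  obtain ⟨P, _, h2, hsk, hcomp, hsize⟩ := HI16Skew.skewComplexity_attained g
  have hs : P.size ≤ 4 * r :=
    hsize.le.trans ((ArithCircuit.skewComplexity_le_four_mul_wsComplexity g).trans
      (Nat.mul_le_mul_left 4 hg))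
  have h := HI16Skew.hasInvRepr_of_isSkew P h2 hsk
  rw [show P.eval = g from hcomp] at h
  refine h.mono (Nat.add_le_add_right (Nat.mul_le_mul (by omega) (by omega)) 2)

/-! ## §C. Algebra of inverse read-outs: base change along `aeval`, and the substitution gadget -/

section ReadOut

variable {k : Type u} [CommRing k] {ρ : Type v} {τ : Type w}

/-- A matrix of determinant one is inverted by its adjugate. [folklore] -/
private theorem inv_eq_adjugate_of_det_eq_one {ι : Type*} [Fintype ι] [DecidableEq ι]
    {S : Type*} [CommRing S] {B : Matrix ι ι S} (hB : B.det = 1) : B⁻¹ = B.adjugate := by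
  rw [Matrix.inv_def, hB, Ring.inverse_one, one_smul]

/-- `aeval` commutes with inverting a matrix of determinant one (both inverses are adjugates,
`AlgHom.map_adjugate`). [folklore] -/
private theorem map_aeval_inv_of_det_eq_one {ι : Type*} [Fintype ι] [DecidableEq ι]
    (g : ρ → MvPolynomial τ k) {B : Matrix ι ι (MvPolynomial ρ k)} (hB : B.det = 1) :
    (B⁻¹).map (aeval g) = (B.map (aeval g))⁻¹ := by
  have hB' : (B.map (aeval g)).det = 1 := by
    rw [← AlgHom.mapMatrix_apply, ← AlgHom.map_det, hB, map_one]
  rw [inv_eq_adjugate_of_det_eq_one hB, inv_eq_adjugate_of_det_eq_one hB',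
    ← AlgHom.mapMatrix_apply, ← AlgHom.mapMatrix_apply, AlgHom.map_adjugate]

/-- **Substitution into an inverse read-out**: for `det B = 1` and constant read-out vectors,
`(vᵀ B⁻¹ w)(g) = vᵀ (B(g))⁻¹ w`, where `B(g)` is `B` with the polynomials `g` substituted into its
entries (`aeval` is a ring homomorphism fixing the constants; it passes through the adjugate).
[cite: BurgisserClausenShokrollahi1997, Thm. (21.27) (proof, property (C))] -/
theorem aeval_readOut {ι : Type*} [Fintype ι] [DecidableEq ι] (g : ρ → MvPolynomial τ k)
    {B : Matrix ι ι (MvPolynomial ρ k)} (hB : B.det = 1) (v w : ι → k) :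
    aeval g ((fun i => C (v i)) ⬝ᵥ B⁻¹ *ᵥ fun j => C (w j)) =
      (fun i => C (v i)) ⬝ᵥ (B.map (aeval g))⁻¹ *ᵥ fun j => C (w j) := by
  rw [← map_aeval_inv_of_det_eq_one g hB]
  simp only [dotProduct, Matrix.mulVec, map_sum, map_mul, Matrix.map_apply, aeval_C,
    algebraMap_eq]

/-- The rank-one border term of the substitution gadget: `(−e_p v'ᵀ) · M · (w' e_qᵀ)` is
`−(v'ᵀ M w')` at `(p, q)` and `0` elsewhere. [folklore] -/
private theorem border_mul_apply {ι ι' : Type*} [Fintype ι'] [DecidableEq ι]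
    (M : Matrix ι' ι' (MvPolynomial τ k)) (v' w' : ι' → k) (p q r c : ι) :
    (((Matrix.of fun i j => if i = p then -(v' j) else 0 : Matrix ι ι' k).map
          (C : k → MvPolynomial τ k)) * M *
        ((Matrix.of fun i j => if j = q then w' i else 0 : Matrix ι' ι k).map
          (C : k → MvPolynomial τ k))) r c =
      if r = p ∧ c = q then -((fun i => C (v' i)) ⬝ᵥ M *ᵥ fun j => C (w' j)) else 0 := by
  simp only [Matrix.mul_apply, Matrix.map_apply, Matrix.of_apply, dotProduct, Matrix.mulVec]
  by_cases hr : r = p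
  · by_cases hc : c = q
    · simp only [hr, hc, if_true, and_self, map_neg, Finset.sum_mul, neg_mul,
        Finset.sum_neg_distrib, Finset.mul_sum]
      rw [Finset.sum_comm]
      refine congrArg _ (Finset.sum_congr rfl fun i _ => Finset.sum_congr rfl fun j _ => ?_)
      ring
    · simp [hr, hc]
  · simp [hr]

/-- **The substitution gadget for inverse read-outs** (edge replacement in algebraic branching
programs, in the matrix form of BCS 1997, Thm. (21.27) / Lemma (21.28)): if `det D = 1` and every
ENTRY of `D` has an inverse read-out `D_{pq} = v_{pq}ᵀ B_{pq}⁻¹ w_{pq}` of size `≤ b`, then every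
constant read-out `vᵀ D⁻¹ w` of the inverse has one of size `≤ |ι|² b + |ι|`: border the block
diagonal matrix `A = ⊕_{pq} B_{pq}` by the constant blocks `W = (w_{pq} e_qᵀ)_{pq}`,
`V = (−e_p v_{pq}ᵀ)_{pq}`, so that `V A⁻¹ W = −D` and the Schur complement of `A` in
`T = [[A, W], [V, 0]]` is `D` — whence `det T = det D = 1`, all entries of `T` are affine, and the
lower-right block of `T⁻¹` is `D⁻¹` (`Matrix.invOf_fromBlocks₁₁_eq`).
[cite: BurgisserClausenShokrollahi1997, Thm. (21.27) (proof), Lemma (21.28)] -/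
theorem hasInvRepr_readOut {ι : Type} [Fintype ι] [DecidableEq ι]
    (D : Matrix ι ι (MvPolynomial τ k)) (hdet : D.det = 1) {b : ℕ}
    (hD : ∀ p q, HasInvRepr (D p q) b) (v w : ι → k) :
    HasInvRepr ((fun i => C (v i)) ⬝ᵥ D⁻¹ *ᵥ fun j => C (w j))
      (Fintype.card ι * Fintype.card ι * b + Fintype.card ι) := by
  classical
  -- invariant: a bordered block-diagonal read-out of the entries in `S`
  have key : ∀ S : Finset (ι × ι), ∃ (κ : Type) (_ : Fintype κ) (_ : DecidableEq κ)
      (A : Matrix κ κ (MvPolynomial τ k)) (Wm : Matrix κ ι k) (Vm : Matrix ι κ k),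
      Fintype.card κ ≤ S.card * b ∧ (∀ i j, (A i j).totalDegree ≤ 1) ∧ A.det = 1 ∧
        Vm.map (C : k → MvPolynomial τ k) * A⁻¹ * Wm.map (C : k → MvPolynomial τ k) =
          -Matrix.of fun p q => if (p, q) ∈ S then D p q else 0 := by
    intro S
    refine Finset.induction_on S ?_ (fun pq S hpq ih => ?_)
    · refine ⟨PEmpty, inferInstance, inferInstance, Matrix.of fun _ _ => 0,
        Matrix.of fun _ _ => 0, Matrix.of fun _ _ => 0, by simp, fun i => i.elim,
        Matrix.det_isEmpty, ?_⟩
      refine Matrix.ext fun p q => ?_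
      simp [Matrix.mul_apply]
    · obtain ⟨κ, _, _, A, Wm, Vm, hcard, hdeg, hdetA, hprod⟩ := ih
      obtain ⟨ι', _, _, B', v', w', hc', hB', hd', hh⟩ := hD pq.1 pq.2
      refine ⟨κ ⊕ ι', inferInstance, inferInstance, Matrix.fromBlocks A 0 0 B',
        Matrix.fromRows Wm (Matrix.of fun i j => if j = pq.2 then w' i else 0),
        Matrix.fromCols Vm (Matrix.of fun i j => if i = pq.1 then -(v' j) else 0),
        ?_, ?_, ?_, ?_⟩
      · rw [Fintype.card_sum, Finset.card_insert_of_notMem hpq, Nat.succ_mul]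
        exact Nat.add_le_add hcard hc'
      · rintro (i | i) (j | j)
        · simpa using hdeg i j
        · simp
        · simp
        · simpa using hB' i j
      · rw [Matrix.det_fromBlocks_zero₂₁, hdetA, hd', mul_one]
      · rw [Matrix.fromRows_map, Matrix.fromCols_map,
          Matrix.inv_fromBlocks_zero₂₁_of_isUnit_iff _ _ _ (iff_of_true
            (HasInvRepr.isUnit_of_det_eq_one hdetA) (HasInvRepr.isUnit_of_det_eq_one hd')),
          Matrix.mul_zero, Matrix.zero_mul, neg_zero, Matrix.fromCols_mul_fromBlocks,
          Matrix.mul_zero, add_zero, Matrix.mul_zero, zero_add, Matrix.fromCols_mul_fromRows,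
          hprod]
        refine Matrix.ext fun r c => ?_
        rw [Matrix.add_apply, border_mul_apply, hh, Matrix.neg_apply, Matrix.neg_apply,
          Matrix.of_apply, Matrix.of_apply]
        simp only [Finset.mem_insert]
        by_cases hrc : (r, c) = pq
        · subst hrc
          simp [hpq]
        · have h' : ¬ (r = pq.1 ∧ c = pq.2) := fun h => hrc (Prod.ext h.1 h.2)
          simp [hrc, h']
  -- all entries treated: `V A⁻¹ W = −D`
  obtain ⟨κ, _, _, A, Wm, Vm, hcard, hdeg, hdetA, hprod⟩ := key Finset.univ
  have hprod' : Vm.map (C : k → MvPolynomial τ k) * A⁻¹ *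
      Wm.map (C : k → MvPolynomial τ k) = -D := by
    rw [hprod]
    congr 1
    exact Matrix.ext fun p q => by simp
  letI iA : Invertible A := Matrix.invertibleOfIsUnitDet A (hdetA ▸ isUnit_one)
  have hS : (0 : Matrix ι ι (MvPolynomial τ k)) -
      Vm.map (C : k → MvPolynomial τ k) * ⅟A * Wm.map (C : k → MvPolynomial τ k) = D := by
    rw [Matrix.invOf_eq_nonsing_inv, hprod', sub_neg_eq_add, zero_add]
  letI iD : Invertible D := Matrix.invertibleOfIsUnitDet D (hdet ▸ isUnit_one)
  letI iS : Invertible ((0 : Matrix ι ι (MvPolynomial τ k)) -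
      Vm.map (C : k → MvPolynomial τ k) * ⅟A * Wm.map (C : k → MvPolynomial τ k)) :=
    iD.copy _ hS
  letI iT : Invertible (Matrix.fromBlocks A (Wm.map (C : k → MvPolynomial τ k))
      (Vm.map (C : k → MvPolynomial τ k)) 0) :=
    Matrix.fromBlocks₁₁Invertible A _ _ _
  have hTinv : (Matrix.fromBlocks A (Wm.map (C : k → MvPolynomial τ k))
      (Vm.map (C : k → MvPolynomial τ k)) 0)⁻¹ =
      Matrix.fromBlocks (⅟A + ⅟A * Wm.map (C : k → MvPolynomial τ k) * ⅟D *
          Vm.map (C : k → MvPolynomial τ k) * ⅟A)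
        (-(⅟A * Wm.map (C : k → MvPolynomial τ k) * ⅟D))
        (-(⅟D * Vm.map (C : k → MvPolynomial τ k) * ⅟A)) ⅟D := by
    rw [← Matrix.invOf_eq_nonsing_inv, Matrix.invOf_fromBlocks₁₁_eq]
    rfl
  refine ⟨κ ⊕ ι, inferInstance, inferInstance, Matrix.fromBlocks A
      (Wm.map (C : k → MvPolynomial τ k)) (Vm.map (C : k → MvPolynomial τ k)) 0,
    Sum.elim 0 v, Sum.elim 0 w, ?_, ?_, ?_, ?_⟩
  · rw [Fintype.card_sum, Finset.card_univ, Fintype.card_prod] at *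
    exact Nat.add_le_add_right hcard _
  · rintro (i | i) (j | j)
    · simpa using hdeg i j
    · simp
    · simp
    · simp
  · rw [Matrix.det_fromBlocks₁₁, hdetA, one_mul, hS, hdet]
  · have hv : (fun i => C (Sum.elim (0 : κ → k) v i)) =
        Sum.elim (0 : κ → MvPolynomial τ k) (fun i => C (v i)) := by
      funext i; cases i <;> simp
    have hw : (fun j => C (Sum.elim (0 : κ → k) w j)) =
        Sum.elim (0 : κ → MvPolynomial τ k) (fun j => C (w j)) := by
      funext j; cases j <;> simp
    rw [hv, hw, hTinv, Matrix.fromBlocks_mulVec, Sum.elim_comp_inl, Sum.elim_comp_inr,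
      sumElim_dotProduct_sumElim, zero_dotProduct, zero_add, Matrix.mulVec_zero, zero_add,
      Matrix.invOf_eq_nonsing_inv]

end ReadOut

/-! ## §D. Substituting polynomials with inverse read-outs into a skew circuit -/

section Compose

variable {k : Type u} [CommRing k] {ρ : Type v} {τ : Type w}

/-- The indicator read-out `e_sᵀ M e_t` is the entry `M s t`. [folklore] -/
private theorem single_readOut {ι : Type*} [Fintype ι] [DecidableEq ι]
    (M : Matrix ι ι (MvPolynomial τ k)) (s t : ι) :
    ((fun i => C (Pi.single (M := fun _ : ι => k) s 1 i)) ⬝ᵥ M *ᵥ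
        fun j => C (Pi.single (M := fun _ : ι => k) t 1 j)) = M s t := by
  have hv : (fun i => C (Pi.single (M := fun _ : ι => k) s 1 i)) =
      (Pi.single s 1 : ι → MvPolynomial τ k) := by
    funext i
    by_cases hi : i = s
    · subst hi; simp
    · simp [Pi.single_eq_of_ne hi]
  have hw : (fun j => C (Pi.single (M := fun _ : ι => k) t 1 j)) =
      (Pi.single t 1 : ι → MvPolynomial τ k) := by
    funext j
    by_cases hj : j = t
    · subst hj; simp
    · simp [Pi.single_eq_of_ne hj]
  rw [hv, hw, Matrix.mulVec_single_one, single_one_dotProduct, Matrix.col_apply]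

/-- **Composition for skew circuits, as an inverse read-out**: if `P` is a fan-in-two skew
circuit with `s` gates over the variables `ρ` and every substituted polynomial `g_i`
(`i : ρ`) has an inverse read-out of size `≤ b`, then `P.eval(g)` has an inverse read-out of
size `≤ K² (b + 6) + K + 2`, `K = (3s+4)(6s+4)`: write `P.eval = ± ((1 − N)⁻¹)_{s₀ t₀}` for the
layered `N` of `HI16Skew.exists_layered_readout` (`det (1 − N) = 1`,
`LayeredABPComputes.det_one_sub` / `inv_one_sub_apply`), substitute (`aeval_readOut`): the entries
of `(1 − N)(g)` are `δ − g_i` or constants, each with a read-out of size `≤ b + 6`, and apply the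
substitution gadget `hasInvRepr_readOut`. No hypothesis on the (possibly infinite) variable type
`ρ`. [cite: BurgisserClausenShokrollahi1997, Thm. (21.27) (proof), Lemma (21.28)]
[cite: MalodPortier2008, Lemma 5] -/
theorem HI16Skew.hasInvRepr_aeval_of_isSkew (P : ArithCircuit k ρ) (h2 : P.IsFanInTwo)
    (hsk : P.IsSkew) (g : ρ → MvPolynomial τ k) {b : ℕ} (hg : ∀ i, HasInvRepr (g i) b) :
    HasInvRepr (aeval g P.eval)
      ((3 * P.size + 4) * (6 * P.size + 4) * ((3 * P.size + 4) * (6 * P.size + 4)) * (b + 6) +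
        (3 * P.size + 4) * (6 * P.size + 4) + 2) := by
  classical
  obtain ⟨layer, N, s₀, t₀, hlay, hvc, hls, hlt, hev⟩ := HI16Skew.exists_layered_readout P h2 hsk
  -- the substituted unipotent matrix `D = (1 − N)(g)`
  have hdet1 : (1 - N).det = 1 := LayeredABPComputes.det_one_sub layer N hlay
  set D : Matrix (Fin ((3 * P.size + 4) * (6 * P.size + 4))) (Fin ((3 * P.size + 4) * (6 * P.size + 4)))
      (MvPolynomial τ k) := (1 - N).map (aeval g) with hD
  have hdetD : D.det = 1 := by
    rw [hD, ← AlgHom.mapMatrix_apply, ← AlgHom.map_det, hdet1, map_one]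
  -- every entry of `D` has a read-out of size `≤ b + 6`
  have hDe : ∀ p q, HasInvRepr (D p q) (b + 6) := by
    intro p q
    rw [hD, Matrix.map_apply, Matrix.sub_apply, map_sub, sub_eq_add_neg]
    have h1 : HasInvRepr (aeval g ((1 : Matrix (Fin ((3 * P.size + 4) * (6 * P.size + 4)))
        (Fin ((3 * P.size + 4) * (6 * P.size + 4))) (MvPolynomial ρ k)) p q)) 2 := by
      refine HasInvRepr.of_totalDegree_le_one ?_
      by_cases hpq : p = q
      · subst hpq
        rw [Matrix.one_apply_eq, map_one, totalDegree_one]; exact Nat.zero_le _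
      · rw [Matrix.one_apply_ne hpq, map_zero, totalDegree_zero]; exact Nat.zero_le _
    have h2 : HasInvRepr (-(aeval g (N p q))) (2 + (b + 2)) := by
      rw [neg_eq_neg_one_mul, show (-1 : MvPolynomial τ k) = C (-1) by rw [map_neg, map_one]]
      refine (HasInvRepr.of_totalDegree_le_one (by rw [totalDegree_C]; exact Nat.zero_le _)).mul ?_
      rcases hvc p q with ⟨x, hx⟩ | ⟨c, hc⟩
      · rw [hx, aeval_X]; exact (hg x).mono (by omega)
      · rw [hc, aeval_C, algebraMap_eq]
        exact (HasInvRepr.of_totalDegree_le_one (by rw [totalDegree_C]; exact Nat.zero_le _)).mono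
          (by omega)
    exact (h1.add h2).mono (by omega)
  -- the substituted read-out of the inverse
  have hR := hasInvRepr_readOut D hdetD hDe (Pi.single s₀ 1) (Pi.single t₀ 1)
  rw [single_readOut, Fintype.card_fin] at hR
  -- `P.eval(g) = ± D⁻¹ s₀ t₀`
  have hev' : aeval g P.eval = C ((-1 : k) ^ (3 * P.size + 3)) * D⁻¹ s₀ t₀ := by
    have hpow : (N ^ (3 * P.size + 3)) s₀ t₀ = (1 - N)⁻¹ s₀ t₀ := by
      rw [LayeredABPComputes.inv_one_sub_apply layer N hlay s₀ t₀, hlt, hls, Nat.sub_zero]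
    rw [hev, map_mul, aeval_C, algebraMap_eq, hpow, hD, ← map_aeval_inv_of_det_eq_one g hdet1,
      Matrix.map_apply]
  rw [hev']
  have hc : HasInvRepr (C ((-1 : k) ^ (3 * P.size + 3)) : MvPolynomial τ k) 2 :=
    HasInvRepr.of_totalDegree_le_one (by rw [totalDegree_C]; exact Nat.zero_le _)
  exact (hc.mul hR).mono (by omega)

/-- **Composition at the level of `L_ws`, as an inverse read-out**: `L_ws(f) ≤ r` and
`L_ws(g_i) ≤ r'` for all `i` give an inverse read-out of `f(g)` of size polynomial in `r, r'`
(through `HI16Skew.skewComplexity_attained`, `L_skew ≤ 4 L_ws`, `hasInvRepr_of_wsComplexity_le`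
and `HI16Skew.hasInvRepr_aeval_of_isSkew`). [cite: Burgisser2024Completeness, §3.1 (p0013 L10–L15)]
[cite: MalodPortier2008, Lemma 5] -/
theorem hasInvRepr_aeval_of_wsComplexity_le {f : MvPolynomial ρ k} {r : ℕ}
    (hf : wsComplexity f ≤ r) (g : ρ → MvPolynomial τ k) {r' : ℕ}
    (hg : ∀ i, wsComplexity (g i) ≤ r') :
    HasInvRepr (aeval g f)
      ((12 * r + 4) * (24 * r + 4) * ((12 * r + 4) * (24 * r + 4)) *
          ((12 * r' + 4) * (24 * r' + 4) + 2 + 6) + (12 * r + 4) * (24 * r + 4) + 2) := by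
  obtain ⟨P, _, h2, hsk, hcomp, hsize⟩ := HI16Skew.skewComplexity_attained f
  have hs : P.size ≤ 4 * r :=
    hsize.le.trans ((ArithCircuit.skewComplexity_le_four_mul_wsComplexity f).trans
      (Nat.mul_le_mul_left 4 hf))
  have h := HI16Skew.hasInvRepr_aeval_of_isSkew P h2 hsk g
    (fun i => hasInvRepr_of_wsComplexity_le (hg i))
  rw [show P.eval = f from hcomp] at h
  have hK : (3 * P.size + 4) * (6 * P.size + 4) ≤ (12 * r + 4) * (24 * r + 4) :=
    Nat.mul_le_mul (by omega) (by omega)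
  refine h.mono (Nat.add_le_add_right (Nat.add_le_add (Nat.mul_le_mul_right _
    (Nat.mul_le_mul hK hK)) hK) 2)

end Compose

/-! ## §E. From inverse read-outs back to weakly-skew circuits, and the class-level closure -/

section WeaklySkewBound

variable {k : Type u} [CommRing k] {τ : Type w}

/-- **Affine decomposition** over any commutative ring: a polynomial of total degree `≤ 1` is
`C a₀ + ∑_t a_t • X_t` with `a₀ = coeff 0` and `a_t = coeff (single t 1)`. [folklore] -/
private theorem eq_C_add_sum_smul_X_of_totalDegree_le_one' [Fintype τ] [DecidableEq τ]
    {a : MvPolynomial τ k} (ha : a.totalDegree ≤ 1) :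
    a = C (coeff 0 a) + ∑ t, coeff (Finsupp.single t 1) a • X t := by
  classical
  apply MvPolynomial.ext
  intro d
  simp only [coeff_add, coeff_C, coeff_sum, coeff_smul, coeff_X, smul_eq_mul, mul_ite, mul_one,
    mul_zero]
  by_cases h0 : d = 0
  · subst h0
    rw [if_pos rfl]
    have : ∀ t : τ, (Finsupp.single t 1 = (0 : τ →₀ ℕ)) = False := fun t =>
      propext ⟨fun h => one_ne_zero (Finsupp.single_eq_zero.1 h), False.elim⟩
    simp [this]
  · rw [if_neg (Ne.symm h0), zero_add]
    by_cases h1 : ∃ t, d = Finsupp.single t 1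
    · obtain ⟨t, rfl⟩ := h1
      rw [Finset.sum_eq_single t]
      · rw [if_pos rfl]
      · intro t' _ ht'
        rw [if_neg]
        intro h
        exact ht' (Finsupp.single_left_injective one_ne_zero h.symm).symm
      · intro h; exact absurd (Finset.mem_univ t) h
    · -- `d` has degree ≥ 2: its coefficient vanishes
      have hsum : ∑ t, (if Finsupp.single t 1 = d then coeff (Finsupp.single t 1) a else 0) = 0 :=
        Finset.sum_eq_zero fun t _ => if_neg fun h => h1 ⟨t, h.symm⟩
      rw [hsum]
      by_contra hne
      have hd : d ∈ a.support := by rw [mem_support_iff]; exact hne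
      have hle : (d.sum fun _ e => e) ≤ 1 := (le_totalDegree hd).trans ha
      rcases Nat.le_one_iff_eq_zero_or_eq_one.1 hle with h | h
      · exact h0 ((Finsupp.degree_eq_zero_iff d).1 h)
      · exact h1 ((Finsupp.sum_eq_one_iff d).1 h |>.imp fun t ht => ht)

/-- **`L_ws(f) ≤ ((N+2)(4N³+7)² + N²)(2 #τ + 3)` whenever `f` has an affine determinantal
representation of size `N`**, over every commutative ring (the tree's
`wsComplexity_le_of_hasDetRepr` is the case `k = ℂ`): an affine determinantal representation is an
affine substitution into `det_N`, substituted into the tree's skew circuit for `det_N`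
(`wsComplexity_aeval_affine_le`, `skewComplexity_detPoly_le`).
[cite: BurgisserEtAl2011, §9.1–§9.2 (det ∈ VP_ws; universality of the determinant)] -/
theorem wsComplexity_le_of_hasDetRepr' [Fintype τ] [DecidableEq τ] {f : MvPolynomial τ k}
    {N : ℕ} (h : HasDetRepr f N) :
    wsComplexity f ≤ ((N + 2) * (4 * N ^ 3 + 7) ^ 2 + N * N) * (2 * Fintype.card τ + 3) := by
  classical
  obtain ⟨A, hAdeg, hAdet⟩ := h
  set a0 : Fin N × Fin N → k := fun ij => coeff 0 (A ij.1 ij.2) with ha0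
  set Ac : Fin N × Fin N → τ → k := fun ij t => coeff (Finsupp.single t 1) (A ij.1 ij.2) with hAc
  have hentry : ∀ ij : Fin N × Fin N, ArithCircuit.SkewSubst.psi a0 Ac ij = A ij.1 ij.2 := by
    intro ij
    rw [ArithCircuit.SkewSubst.psi, ha0, hAc]
    exact (eq_C_add_sum_smul_X_of_totalDegree_le_one' (hAdeg ij.1 ij.2)).symm
  have hpsi : ArithCircuit.SkewSubst.psi a0 Ac = fun p : Fin N × Fin N => A p.1 p.2 :=
    funext hentry
  have hf : f = aeval (ArithCircuit.SkewSubst.psi a0 Ac) (detPoly (Fin N) k) := by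
    rw [hpsi, detPoly, AlgHom.map_det, Matrix.mvPolynomialX_mapMatrix_aeval, hAdet]
  rw [hf]
  refine (wsComplexity_aeval_affine_le a0 Ac _).trans ?_
  have hc : Fintype.card (Fin N × Fin N) = N * N := by simp
  rw [hc]
  exact Nat.mul_le_mul_right _ (Nat.add_le_add_right (skewComplexity_detPoly_le k N) _)

/-- **Inverse read-outs have small weakly-skew circuits**: `HasInvRepr g m` gives
`L_ws(g) ≤ ((m+3)(4(m+1)³+7)² + (m+1)²)(2 #τ + 3)` (bordering, `HasInvRepr.hasDetRepr`, then
`wsComplexity_le_of_hasDetRepr'`). [cite: BurgisserClausenShokrollahi1997, Thm. (21.27)]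
[cite: BurgisserEtAl2011, §9.1–§9.2 (det ∈ VP_ws; universality of the determinant)] -/
theorem wsComplexity_le_of_hasInvRepr [Fintype τ] [DecidableEq τ] {g : MvPolynomial τ k} {m : ℕ}
    (h : HasInvRepr g m) :
    wsComplexity g ≤
      ((m + 1 + 2) * (4 * (m + 1) ^ 3 + 7) ^ 2 + (m + 1) * (m + 1)) * (2 * Fintype.card τ + 3) :=
  wsComplexity_le_of_hasDetRepr' h.hasDetRepr

end WeaklySkewBound

/-! ## §F. `VBP = VP_ws` is closed under composition (families) -/

section Classes

variable {k : Type u} [CommRing k] {ρ : ℕ → Type v} {τ : ℕ → Type w}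
  [∀ n, Fintype (τ n)] [∀ n, DecidableEq (τ n)]

/-- The quadratic size function `(12a+4)(24a+4)` of `hasInvRepr_of_wsComplexity_le` is
p-bounded along a p-bounded `a`. [cite: Burgisser2000, Def. 2.1(1)] -/
private theorem isPBounded_quadSize {a : ℕ → ℕ} (ha : IsPBounded a) :
    IsPBounded fun n => (12 * a n + 4) * (24 * a n + 4) :=
  IsPBounded.mul_holds
    (IsPBounded.add_holds (IsPBounded.mul_holds (IsPBounded.const 12) ha) (IsPBounded.const 4))
    (IsPBounded.add_holds (IsPBounded.mul_holds (IsPBounded.const 24) ha) (IsPBounded.const 4))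

/-- The maximum of the first `v(n)` values of a p-bounded function, `v` p-bounded, is p-bounded
(as `IsPBounded.sup_fin` of `VNPClosedUnderComposition.lean`, re-derived to keep imports light).
[cite: Burgisser2000, Def. 2.1(1)] -/
private theorem isPBounded_sup_fin' {s v : ℕ → ℕ} (hs : IsPBounded s) (hv : IsPBounded v) :
    IsPBounded fun n => Finset.univ.sup fun i : Fin (v n) => s i := by
  obtain ⟨c, hc⟩ := hs
  refine (IsPBounded.comp_holds (s := fun m => m ^ c + c) ⟨c, fun n => le_rfl⟩ hv).mono fun n => ?_
  refine Finset.sup_le fun i _ => (hc i).trans ?_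
  exact Nat.add_le_add_right (Nat.pow_le_pow_left i.is_lt.le c) c

/-- **Families with p-bounded inverse read-outs (in p-boundedly many variables) are in
`VBP = VP_ws`** (`wsComplexity_le_of_hasInvRepr`; the "algebraic branching programs of
polynomial size" direction of Malod–Portier's `VP_ws = VBP`).
[cite: MalodPortier2008, Prop. 5, Lemma 6] [cite: BurgisserEtAl2011, §9.1–§9.2 (det ∈ VP_ws; universality of the determinant)] -/
theorem isVPwsFamily_of_hasInvRepr {f : ∀ n, MvPolynomial (τ n) k} {m : ℕ → ℕ}
    (hm : IsPBounded m) (hτ : IsPBounded fun n => Fintype.card (τ n))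
    (h : ∀ n, HasInvRepr (f n) (m n)) : IsVPwsFamily f := by
  have hm1 : IsPBounded fun n => m n + 1 := IsPBounded.add_holds hm (IsPBounded.const 1)
  have hB : IsPBounded fun n =>
      ((m n + 1 + 2) * (4 * (m n + 1) ^ 3 + 7) ^ 2 + (m n + 1) * (m n + 1)) *
        (2 * Fintype.card (τ n) + 3) :=
    IsPBounded.mul_holds
      (IsPBounded.add_holds
        (IsPBounded.mul_holds (IsPBounded.add_holds hm1 (IsPBounded.const 2))
          (IsPBounded.pow_holds (IsPBounded.add_holds (IsPBounded.mul_holds (IsPBounded.const 4)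
            (IsPBounded.pow_holds hm1 3)) (IsPBounded.const 7)) 2))
        (IsPBounded.mul_holds hm1 hm1))
      (IsPBounded.add_holds (IsPBounded.mul_holds (IsPBounded.const 2) hτ) (IsPBounded.const 3))
  exact hB.mono fun n => wsComplexity_le_of_hasInvRepr (h n)

/-- **`VP_ws` = families with p-bounded inverse read-outs** (for families in p-boundedly many
variables): Malod–Portier's `VP_ws = VBP` with algebraic branching programs in the matrix form
`vᵀ B⁻¹ w` (`hasInvRepr_of_wsComplexity_le` and `isVPwsFamily_of_hasInvRepr`).
[cite: MalodPortier2008, Prop. 5, Lemma 6] -/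
theorem isVPwsFamily_iff_exists_hasInvRepr {f : ∀ n, MvPolynomial (τ n) k}
    (hτ : IsPBounded fun n => Fintype.card (τ n)) :
    IsVPwsFamily f ↔ ∃ m : ℕ → ℕ, IsPBounded m ∧ ∀ n, HasInvRepr (f n) (m n) := by
  constructor
  · rintro ⟨c, hc⟩
    exact ⟨fun n => (12 * (n ^ c + c) + 4) * (24 * (n ^ c + c) + 4) + 2,
      IsPBounded.add_holds (isPBounded_quadSize ⟨c, fun n => le_rfl⟩) (IsPBounded.const 2),
      fun n => hasInvRepr_of_wsComplexity_le (hc n)⟩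
  · rintro ⟨m, hm, h⟩
    exact isVPwsFamily_of_hasInvRepr hm hτ h

/-- **`VBP = VP_ws` is closed under composition** (substitution form; Bürgisser 2024, §3.1:
"all the complexity classes introduced before are closed under … compositions"): if
`(f_n) ∈ VP_ws`, `f_n ∈ k[ρ_n]`, and `g_n = (g_{n,i})_{i ∈ ρ_n}` are tuples of polynomials in
`k[τ_n]` with `#τ_n` p-bounded and `L_ws(g_{n,i}) ≤ B(n)` for a p-bounded `B`, then
`(f_n(g_n))_n ∈ VP_ws`. Proof by inverse read-outs (algebraic branching programs as
`vᵀ B⁻¹ w`): `hasInvRepr_aeval_of_wsComplexity_le` and `isVPwsFamily_of_hasInvRepr`. Every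
commutative ring; no hypothesis on the variable types `ρ_n` of the outer family.
[cite: Burgisser2024Completeness, §3.1 (p0013 L10–L15)] -/
theorem IsVPwsFamily.aeval {f : ∀ n, MvPolynomial (ρ n) k} (hf : IsVPwsFamily f)
    (g : ∀ n, ρ n → MvPolynomial (τ n) k) (hτ : IsPBounded fun n => Fintype.card (τ n))
    {B : ℕ → ℕ} (hB : IsPBounded B) (hg : ∀ n i, wsComplexity (g n i) ≤ B n) :
    IsVPwsFamily fun n => MvPolynomial.aeval (g n) (f n) := by
  obtain ⟨c, hc⟩ := hf
  have hr : IsPBounded fun n => n ^ c + c := ⟨c, fun n => le_rfl⟩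
  have hK := isPBounded_quadSize hr
  have hKB := isPBounded_quadSize hB
  refine isVPwsFamily_of_hasInvRepr (m := fun n =>
      (12 * (n ^ c + c) + 4) * (24 * (n ^ c + c) + 4) *
          ((12 * (n ^ c + c) + 4) * (24 * (n ^ c + c) + 4)) *
          ((12 * B n + 4) * (24 * B n + 4) + 2 + 6) +
        (12 * (n ^ c + c) + 4) * (24 * (n ^ c + c) + 4) + 2) ?_ hτ
    fun n => hasInvRepr_aeval_of_wsComplexity_le (hc n) (g n) (hg n)
  exact IsPBounded.add_holds (IsPBounded.add_holds (IsPBounded.mul_holds (IsPBounded.mul_holds hK hK)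
    (IsPBounded.add_holds (IsPBounded.add_holds hKB (IsPBounded.const 2)) (IsPBounded.const 6))) hK)
    (IsPBounded.const 2)

/-- **`VBP = VP_ws` is closed under composition, as printed** (Bürgisser 2024, §3.1: "forming
`(f_n(g_1, …, g_{v(n)}))` from sequences `(f_n)` and `(g_n)`, where `f_n ∈ 𝔽[x_1, …, x_{v(n)}]`"):
for `VP_ws` families `(f_n)`, `f_n ∈ k[X_0, …, X_{v(n)-1}]` with `v` p-bounded, and `(g_n)`,
`g_n ∈ k[X_0, …, X_{w(n)-1}]`, the composite family `(f_n(g_0, …, g_{v(n)-1}))_n` — the members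
`g_0, …, g_{v(n)-1}` read in a common `k[X_0, …, X_{W(n)-1}]`, `w(i) ≤ W(n)` for `i < v(n)`, `W`
p-bounded — is a `VP_ws` family (`IsVPwsFamily.aeval`; the first `v(n)` members of a `VP_ws`
family have `L_ws ≤ max_{i<v(n)} (i^c + c)`, p-bounded since `v` is;
renaming variables does not increase `L_ws`, `IsProjection.wsComplexity_le`). The hypothesis
"`v` p-bounded" is the tree's rendering of `f_n` having p-boundedly many variables (implicit in
print, where the inputs count towards the circuit size).
[cite: Burgisser2024Completeness, §3.1 (p0013 L10–L15)] -/
theorem IsVPwsFamily.comp {v w : ℕ → ℕ} {f : ∀ n, MvPolynomial (Fin (v n)) k}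
    {g : ∀ n, MvPolynomial (Fin (w n)) k} (hf : IsVPwsFamily f) (hg : IsVPwsFamily g)
    (hv : IsPBounded v) {W : ℕ → ℕ} (hW : ∀ n (i : Fin (v n)), w i ≤ W n) (hWp : IsPBounded W) :
    IsVPwsFamily fun n =>
      MvPolynomial.aeval (fun i : Fin (v n) => rename (Fin.castLE (hW n i)) (g i)) (f n) := by
  obtain ⟨d, hd⟩ := hg
  have hs : IsPBounded fun m : ℕ => m ^ d + d := ⟨d, fun m => le_rfl⟩
  refine hf.aeval _ (hWp.mono fun n => by rw [Fintype.card_fin])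
    (B := fun n => Finset.univ.sup fun i : Fin (v n) => (i : ℕ) ^ d + d) (isPBounded_sup_fin' hs hv)
    fun n i => ?_
  exact ((isProjection_rename _ (g i)).wsComplexity_le.trans (hd i)).trans
    (Finset.le_sup (f := fun i : Fin (v n) => (i : ℕ) ^ d + d) (Finset.mem_univ i))

end Classes

/-! ## §G. `VBP = VP_ws` is closed under sums and products (Bürgisser 2024, §3.1) -/

section Operations

variable {k : Type u} [CommRing k] {τ : Type w}

/-- **`L_ws(f + g) ≤ 4 L_ws(f) + 4 L_ws(g) + 3`** (through the tree's
`ArithCircuit.skewComplexity_add_le` and `L_ws ≤ L_skew ≤ 4 L_ws`).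
[cite: Burgisser2024Completeness, §3.1 (p0013 L10–L15)] -/
theorem wsComplexity_add_le_four (f g : MvPolynomial τ k) :
    wsComplexity (f + g) ≤ 4 * wsComplexity f + 4 * wsComplexity g + 3 := by
  have h1 := ArithCircuit.skewComplexity_le_four_mul_wsComplexity f
  have h2 := ArithCircuit.skewComplexity_le_four_mul_wsComplexity g
  have h3 := ArithCircuit.skewComplexity_add_le f g
  have h4 := HI16Skew.wsComplexity_le_skewComplexity (f + g)
  omega

/-- **Products as inverse read-outs**: `L_ws(f) ≤ r`, `L_ws(g) ≤ r'` give a read-out of `f · g`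
of size `(12r+4)(24r+4) + (12r'+4)(24r'+4) + 4` (`HasInvRepr.mul`, BCS Thm. (21.27) Case 2).
[cite: BurgisserClausenShokrollahi1997, Thm. (21.27) (proof, Case 2)] -/
theorem hasInvRepr_mul_of_wsComplexity_le {f g : MvPolynomial τ k} {r r' : ℕ}
    (hf : wsComplexity f ≤ r) (hg : wsComplexity g ≤ r') :
    HasInvRepr (f * g) ((12 * r + 4) * (24 * r + 4) + 2 + ((12 * r' + 4) * (24 * r' + 4) + 2)) :=
  (hasInvRepr_of_wsComplexity_le hf).mul (hasInvRepr_of_wsComplexity_le hg)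

/-- **`L_ws(f · g)` is polynomially bounded in `L_ws(f)`, `L_ws(g)` and the number of variables**
(through inverse read-outs; the printed argument — one product gate on top of two separate
weakly-skew sub-circuits, `L_ws(fg) ≤ L_ws(f) + L_ws(g) + 1` — is linear;
TODO(sharper form): the linear bound needs the sub-circuit bookkeeping of `IsWeaklySkew`).
[cite: Burgisser2024Completeness, §3.1 (p0013 L10–L15)] -/
theorem wsComplexity_mul_le_poly [Fintype τ] [DecidableEq τ] (f g : MvPolynomial τ k) :
    wsComplexity (f * g) ≤
      (((12 * wsComplexity f + 4) * (24 * wsComplexity f + 4) + 2 +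
            ((12 * wsComplexity g + 4) * (24 * wsComplexity g + 4) + 2) + 1 + 2) *
          (4 * ((12 * wsComplexity f + 4) * (24 * wsComplexity f + 4) + 2 +
            ((12 * wsComplexity g + 4) * (24 * wsComplexity g + 4) + 2) + 1) ^ 3 + 7) ^ 2 +
        ((12 * wsComplexity f + 4) * (24 * wsComplexity f + 4) + 2 +
            ((12 * wsComplexity g + 4) * (24 * wsComplexity g + 4) + 2) + 1) *
          ((12 * wsComplexity f + 4) * (24 * wsComplexity f + 4) + 2 +
            ((12 * wsComplexity g + 4) * (24 * wsComplexity g + 4) + 2) + 1)) *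
        (2 * Fintype.card τ + 3) :=
  wsComplexity_le_of_hasInvRepr (hasInvRepr_mul_of_wsComplexity_le le_rfl le_rfl)

variable {σ : ℕ → Type v}

/-- **`VBP = VP_ws` is closed under sums** (Bürgisser 2024, §3.1). Every commutative ring.
[cite: Burgisser2024Completeness, §3.1 (p0013 L10–L15)] -/
theorem IsVPwsFamily.add {f g : ∀ n, MvPolynomial (σ n) k} (hf : IsVPwsFamily f)
    (hg : IsVPwsFamily g) : IsVPwsFamily fun n => f n + g n :=
  (IsPBounded.add_holds (IsPBounded.add_holds (IsPBounded.mul_holds (IsPBounded.const 4) hf)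
    (IsPBounded.mul_holds (IsPBounded.const 4) hg)) (IsPBounded.const 3)).mono
    fun n => wsComplexity_add_le_four (f n) (g n)

/-- **`VBP = VP_ws` is closed under products** (Bürgisser 2024, §3.1), for families in
p-boundedly many variables, every commutative ring (through inverse read-outs,
`hasInvRepr_mul_of_wsComplexity_le` and `isVPwsFamily_of_hasInvRepr`).
[cite: Burgisser2024Completeness, §3.1 (p0013 L10–L15)] -/
theorem IsVPwsFamily.mul [∀ n, Fintype (σ n)] [∀ n, DecidableEq (σ n)]
    {f g : ∀ n, MvPolynomial (σ n) k} (hf : IsVPwsFamily f) (hg : IsVPwsFamily g)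
    (hσ : IsPBounded fun n => Fintype.card (σ n)) : IsVPwsFamily fun n => f n * g n := by
  obtain ⟨c, hc⟩ := hf
  obtain ⟨d, hd⟩ := hg
  refine isVPwsFamily_of_hasInvRepr (m := fun n =>
      (12 * (n ^ c + c) + 4) * (24 * (n ^ c + c) + 4) + 2 +
        ((12 * (n ^ d + d) + 4) * (24 * (n ^ d + d) + 4) + 2)) ?_ hσ
    fun n => hasInvRepr_mul_of_wsComplexity_le (hc n) (hd n)
  exact IsPBounded.add_holds (IsPBounded.add_holds (isPBounded_quadSize ⟨c, fun n => le_rfl⟩)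
    (IsPBounded.const 2)) (IsPBounded.add_holds (isPBounded_quadSize ⟨d, fun n => le_rfl⟩)
    (IsPBounded.const 2))

end Operations

end Literature.Computability.AlgebraicComplexity
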